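import Summits.QuantumFields.YangMills.Theses.EntropyBudgetEquipartition
import Summits.QuantumFields.YangMills.Theorems.SourcedPressureJensenJensenFloorStubJensen
import Summits.QuantumFields.YangMills.Theorems.SourcedPressureJensenJensenFloorStubCentredSum
import HarnessLib

/-!
# Route `EntropyBudgetEquipartition`, crux `EntropyBudgetTransfer` (stmt-QuantumFields-22401) — the sourced pressure bound is needed at ONE source strength `h = ±β^(−s)` only

HONEST LABEL: helper lemmas toward a RECORD-label rung (R2ξ-G, `WeakCouplingRates.XiPow`, an UPPER bound on the lattice gap);
nothing here bears on the Clay Yang–Mills mass gap, which is NOT proved by any of this.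

The reductions «sourced pressure increment bound ⇒ one- or two-sided free-gluon law» (`JensenFloor_of`,
`TwoSignedSource.twoSidedLaw_of_twoSignedSource`, `OneSidedLaws.*`) quantify the source strength over a whole interval
`0 < |h| ≤ h₀` but USE it at the single value `|h| = β^(−κ/2)`.  A prover of the sourced bound (LINE 2's crux KS and its
negative-`h` mirror) therefore only needs it along ONE curve `h = β^(−s)` with any fixed `0 < s < κ` — a genuinely weaker target
(the tilt `e^{∓β^(−s) H}` is a vanishing per-site perturbation, no uniformity in `h` is asked).  This file records that, with every
constant explicit and pointwise in `(G, r)`: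

* `lower_core'` / `upper_core'` — the real arithmetic with a free error term `R`: Jensen `∓ηE ≤ P`, `V·P ≤ ∓ησS + R`, `V·E = β²X`
  give `σS − R/η ≤ β²X`, resp. `β²X ≤ σS + R/η`;
* `lowerLaw_of_posSource_at` — the bound at `h = β^(−s)` only, `|Λ|⁻¹ log E e^{−β^(−s) H} ≤ −β^(−s) σ C(n)² + C β^(−κ) + M β^(−2s)`
  (`β ≥ β₀`, `1 ≤ n ≤ 2β^A`, eventually in `L`), gives `σ C(n)² − (|C| + |M|) β^(−min (κ−s) s) ≤ β² Cov` for `β ≥ max β₀ 1`;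
* `upperLaw_of_negSource_at` — the mirrored bound at `h = −β^(−s)` gives `β² Cov ≤ σ C(n)² + (|C| + |M|) β^(−min (κ−s) s)`;
* `twoSidedLaw_of_twoSignedSource_at`, `entropyBudgetTransfer_of_twoSignedSource_at` — both signs at the single strength
  `β^(−s)` (common `σ`, `0 < s < κ`) give the two-sided law with exponent `min (κ − s) s`, hence the crux.

Tools: `stub_jensen` (Jensen on the torus, every real `h`) and `stub_centredSum` of the landed `JensenFloor` stubs. [folklore]
-/

noncomputable section

namespace Summit.QuantumFields.YangMills.Theorems.EntropyBudgetEquipartition.SingleStrengthSource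

open MeasureTheory Filter
open Literature.MathematicalPhysics.QuantumFieldTheory Literature.MathematicalPhysics.QuantumLattice
  Summit.QuantumFields.YangMills.Theorems.WeakCouplingRates
  Summit.QuantumFields.YangMills.Cruxes.JensenFloor.Birth

/-! ### Real arithmetic cores with a free error term -/

/-- Lower core: `−ηE ≤ P`, `V·P ≤ −ησS + R₁ + R₂`, `V·E = β²X` (`η, V > 0`) give `σS − (R₁ + R₂)/η ≤ β²X`. [folklore] -/
theorem lower_core' {V E P X S σ R₁ R₂ η β : ℝ} (hV : 0 < V) (hη : 0 < η)
    (j : -η * E ≤ P) (hb : V * P ≤ -η * (σ * S) + R₁ + R₂) (c : V * E = β ^ 2 * X) :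
    σ * S - (R₁ + R₂) / η ≤ β ^ 2 * X := by
  have j' : V * (-η * E) ≤ V * P := mul_le_mul_of_nonneg_left j hV.le
  have e1 : V * (-η * E) = -η * (β ^ 2 * X) := by rw [← c]; ring
  have h1 : η * (σ * S) - (R₁ + R₂) ≤ η * (β ^ 2 * X) := by linarith
  have h2 : η * (σ * S - (R₁ + R₂) / η) = η * (σ * S) - (R₁ + R₂) := by field_simp
  exact le_of_mul_le_mul_left (by linarith [h2.le, h2.ge]) hη

/-- Upper core: `ηE ≤ P`, `V·P ≤ ησS + R₁ + R₂`, `V·E = β²X` (`η, V > 0`) give `β²X ≤ σS + (R₁ + R₂)/η`. [folklore] -/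
theorem upper_core' {V E P X S σ R₁ R₂ η β : ℝ} (hV : 0 < V) (hη : 0 < η)
    (j : η * E ≤ P) (hb : V * P ≤ η * (σ * S) + R₁ + R₂) (c : V * E = β ^ 2 * X) :
    β ^ 2 * X ≤ σ * S + (R₁ + R₂) / η := by
  have j' : V * (η * E) ≤ V * P := mul_le_mul_of_nonneg_left j hV.le
  have e1 : V * (η * E) = η * (β ^ 2 * X) := by rw [← c]; ring
  have h1 : η * (β ^ 2 * X) ≤ η * (σ * S) + (R₁ + R₂) := by linarith
  have h2 : η * (σ * S + (R₁ + R₂) / η) = η * (σ * S) + (R₁ + R₂) := by field_simp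
  exact le_of_mul_le_mul_left (by linarith [h2.le, h2.ge]) hη

/-- Exponent bookkeeping at the single strength `η = β^(−s)`: for `β ≥ 1` (and any real `s, κ`),
`(C β^(−κ) + M η²)/η ≤ (|C| + |M|) β^(−min (κ−s) s)`. [folklore] -/
theorem error_div_le {β s κ C M : ℝ} (hβ : 1 ≤ β) :
    (C * β ^ (-κ) + M * (β ^ (-s)) ^ 2) / β ^ (-s) ≤ (|C| + |M|) * β ^ (-min (κ - s) s) := by
  have hβpos : 0 < β := by linarith
  have hη : 0 < β ^ (-s) := Real.rpow_pos_of_pos hβpos _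
  have t1 : C * β ^ (-κ) / β ^ (-s) = C * β ^ (-(κ - s)) := by
    rw [mul_div_assoc, ← Real.rpow_sub hβpos, show -κ - -s = -(κ - s) by ring]
  have t2 : M * (β ^ (-s)) ^ 2 / β ^ (-s) = M * β ^ (-s) := by
    rw [mul_div_assoc, sq, mul_div_cancel_right₀ _ hη.ne']
  rw [add_div, t1, t2]
  have h1 : β ^ (-(κ - s)) ≤ β ^ (-min (κ - s) s) :=
    Real.rpow_le_rpow_of_exponent_le hβ (neg_le_neg (min_le_left _ _))
  have h2 : β ^ (-s) ≤ β ^ (-min (κ - s) s) :=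
    Real.rpow_le_rpow_of_exponent_le hβ (neg_le_neg (min_le_right _ _))
  have hp1 : 0 ≤ β ^ (-(κ - s)) := Real.rpow_nonneg hβpos.le _
  have a1 : C * β ^ (-(κ - s)) ≤ |C| * β ^ (-min (κ - s) s) :=
    (mul_le_mul_of_nonneg_right (le_abs_self C) hp1).trans (mul_le_mul_of_nonneg_left h1 (abs_nonneg C))
  have a2 : M * β ^ (-s) ≤ |M| * β ^ (-min (κ - s) s) :=
    (mul_le_mul_of_nonneg_right (le_abs_self M) hη.le).trans (mul_le_mul_of_nonneg_left h2 (abs_nonneg M))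
  linarith

/-! ### One-sided and two-sided laws from the bound at the single strength `β^(−s)` -/

section OneStrength

variable (G : Type) [Group G] [TopologicalSpace G] [IsTopologicalGroup G] [CompactSpace G]
  [MeasurableSpace G] [BorelSpace G] (r : LatticeRep G)

/-- **Lower law from the positive source at the single strength `h = β^(−s)`** (pointwise in `(G, r)`, constants explicit; useful
for `0 < s < κ`). [folklore] -/
theorem lowerLaw_of_posSource_at {κ s A M C σ β₀ : ℝ}
    (hKS : ∀ β : ℝ, β₀ ≤ β → ∀ n : ℕ, 1 ≤ n → (n : ℝ) ≤ 2 * β ^ A → ∀ᶠ L : ℕ in Filter.atTop,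
        ((L + 1 : ℝ) ^ 4)⁻¹ * Real.log (wilsonExpectation (L := L + 1) r.ρ β fun U => Real.exp (-(β ^ (-s)) *
          ∑ x : Fin 4 → Fin (L + 1),
          toTorusObservable (L + 1) (fun V => (β * plaqCost0 (d := 4) r.ρ 1 2 (configShift (fun i => -((x i : ℕ) : ℤ)) V) -
            β * wilsonExpectation (L := L + 1) r.ρ β (toTorusObservable (L + 1) (plaqCost0 (d := 4) r.ρ 1 2))) *
            (β * plaqCost0 (d := 4) r.ρ 1 2 (timeShiftLG (G := G) n (configShift (fun i => -((x i : ℕ) : ℤ)) V)) -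
              β * wilsonExpectation (L := L + 1) r.ρ β (toTorusObservable (L + 1) (plaqCost0 (d := 4) r.ρ 1 2)))) U)) ≤
          -(β ^ (-s)) * (σ * (curvaturePlaquetteCorr (d := 4) (by norm_num) (n : ℤ)) ^ 2) + C * β ^ (-κ) + M * (β ^ (-s)) ^ 2) :
    ∀ β : ℝ, max β₀ 1 ≤ β → ∀ n : ℕ, 1 ≤ n → (n : ℝ) ≤ 2 * β ^ A →
      ∀ᶠ L : ℕ in Filter.atTop,
        σ * (curvaturePlaquetteCorr (d := 4) (by norm_num) (n : ℤ)) ^ 2 - (|C| + |M|) * β ^ (-min (κ - s) s) ≤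
        β ^ 2 * (wilsonExpectation (L := L + 1) r.ρ β (toTorusObservable (L + 1) fun U =>
            plaqCost0 (d := 4) r.ρ 1 2 U * plaqCost0 (d := 4) r.ρ 1 2 (timeShiftLG (G := G) n U)) -
          wilsonExpectation (L := L + 1) r.ρ β (toTorusObservable (L + 1) (plaqCost0 (d := 4) r.ρ 1 2)) *
            wilsonExpectation (L := L + 1) r.ρ β (toTorusObservable (L + 1) fun U =>
              plaqCost0 (d := 4) r.ρ 1 2 (timeShiftLG (G := G) n U))) := by
  intro β hβ n hn1 hn2
  have hβ₀ : β₀ ≤ β := (le_max_left _ _).trans hβ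
  have hβ1 : (1 : ℝ) ≤ β := (le_max_right _ _).trans hβ
  have hβpos : 0 < β := by linarith
  have hη : 0 < β ^ (-s) := Real.rpow_pos_of_pos hβpos _
  filter_upwards [hKS β hβ₀ n hn1 hn2] with L hL
  have j := stub_jensen G r β n (β ^ (-s)) L
  have c := stub_centredSum G r β n L
  have hV : (0 : ℝ) < ((L + 1 : ℝ) ^ 4)⁻¹ := by positivity
  have main := lower_core' hV hη j hL c
  have herr := error_div_le (s := s) (κ := κ) (C := C) (M := M) hβ1
  linarith

/-- **Upper law from the negative source at the single strength `h = −β^(−s)`** (pointwise in `(G, r)`, constants explicit; useful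
for `0 < s < κ`). [folklore] -/
theorem upperLaw_of_negSource_at {κ s A M C σ β₀ : ℝ}
    (hKS : ∀ β : ℝ, β₀ ≤ β → ∀ n : ℕ, 1 ≤ n → (n : ℝ) ≤ 2 * β ^ A → ∀ᶠ L : ℕ in Filter.atTop,
        ((L + 1 : ℝ) ^ 4)⁻¹ * Real.log (wilsonExpectation (L := L + 1) r.ρ β fun U => Real.exp (β ^ (-s) *
          ∑ x : Fin 4 → Fin (L + 1),
          toTorusObservable (L + 1) (fun V => (β * plaqCost0 (d := 4) r.ρ 1 2 (configShift (fun i => -((x i : ℕ) : ℤ)) V) -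
            β * wilsonExpectation (L := L + 1) r.ρ β (toTorusObservable (L + 1) (plaqCost0 (d := 4) r.ρ 1 2))) *
            (β * plaqCost0 (d := 4) r.ρ 1 2 (timeShiftLG (G := G) n (configShift (fun i => -((x i : ℕ) : ℤ)) V)) -
              β * wilsonExpectation (L := L + 1) r.ρ β (toTorusObservable (L + 1) (plaqCost0 (d := 4) r.ρ 1 2)))) U)) ≤
          β ^ (-s) * (σ * (curvaturePlaquetteCorr (d := 4) (by norm_num) (n : ℤ)) ^ 2) + C * β ^ (-κ) + M * (β ^ (-s)) ^ 2) :
    ∀ β : ℝ, max β₀ 1 ≤ β → ∀ n : ℕ, 1 ≤ n → (n : ℝ) ≤ 2 * β ^ A →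
      ∀ᶠ L : ℕ in Filter.atTop,
        β ^ 2 * (wilsonExpectation (L := L + 1) r.ρ β (toTorusObservable (L + 1) fun U =>
            plaqCost0 (d := 4) r.ρ 1 2 U * plaqCost0 (d := 4) r.ρ 1 2 (timeShiftLG (G := G) n U)) -
          wilsonExpectation (L := L + 1) r.ρ β (toTorusObservable (L + 1) (plaqCost0 (d := 4) r.ρ 1 2)) *
            wilsonExpectation (L := L + 1) r.ρ β (toTorusObservable (L + 1) fun U =>
              plaqCost0 (d := 4) r.ρ 1 2 (timeShiftLG (G := G) n U))) ≤
        σ * (curvaturePlaquetteCorr (d := 4) (by norm_num) (n : ℤ)) ^ 2 + (|C| + |M|) * β ^ (-min (κ - s) s) := by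
  intro β hβ n hn1 hn2
  have hβ₀ : β₀ ≤ β := (le_max_left _ _).trans hβ
  have hβ1 : (1 : ℝ) ≤ β := (le_max_right _ _).trans hβ
  have hβpos : 0 < β := by linarith
  have hη : 0 < β ^ (-s) := Real.rpow_pos_of_pos hβpos _
  filter_upwards [hKS β hβ₀ n hn1 hn2] with L hL
  have j := stub_jensen G r β n (-(β ^ (-s))) L
  have c := stub_centredSum G r β n L
  simp only [neg_neg] at j
  have hV : (0 : ℝ) < ((L + 1 : ℝ) ^ 4)⁻¹ := by positivity
  have main := upper_core' hV hη j hL c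
  have herr := error_div_le (s := s) (κ := κ) (C := C) (M := M) hβ1
  linarith

/-- **Two-sided law from both signs at the single strength `β^(−s)`** (common `σ`, `0 < s < κ`; pointwise in `(G, r)`): exponent
`min (κ − s) s`, constant `|C| + |M|`, threshold `max β₀ 1`. [folklore] -/
theorem twoSidedLaw_of_twoSignedSource_at {κ s A M C σ β₀ : ℝ} (hs : 0 < s) (hsκ : s < κ) (hA : 0 < A) (hσ : 0 < σ)
    (hKS : ∀ β : ℝ, β₀ ≤ β → ∀ n : ℕ, 1 ≤ n → (n : ℝ) ≤ 2 * β ^ A → ∀ h : ℝ, (h = β ^ (-s) ∨ h = -(β ^ (-s))) →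
      ∀ᶠ L : ℕ in Filter.atTop,
        ((L + 1 : ℝ) ^ 4)⁻¹ * Real.log (wilsonExpectation (L := L + 1) r.ρ β fun U => Real.exp (-h * ∑ x : Fin 4 → Fin (L + 1),
          toTorusObservable (L + 1) (fun V => (β * plaqCost0 (d := 4) r.ρ 1 2 (configShift (fun i => -((x i : ℕ) : ℤ)) V) -
            β * wilsonExpectation (L := L + 1) r.ρ β (toTorusObservable (L + 1) (plaqCost0 (d := 4) r.ρ 1 2))) *
            (β * plaqCost0 (d := 4) r.ρ 1 2 (timeShiftLG (G := G) n (configShift (fun i => -((x i : ℕ) : ℤ)) V)) -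
              β * wilsonExpectation (L := L + 1) r.ρ β (toTorusObservable (L + 1) (plaqCost0 (d := 4) r.ρ 1 2)))) U)) ≤
          -h * (σ * (curvaturePlaquetteCorr (d := 4) (by norm_num) (n : ℤ)) ^ 2) + C * β ^ (-κ) + M * h ^ 2) :
    ∃ κ' A' C' σ' β₁ : ℝ, 0 < κ' ∧ 0 < A' ∧ 0 < σ' ∧ ∀ β : ℝ, β₁ ≤ β → ∀ n : ℕ, 1 ≤ n → (n : ℝ) ≤ 2 * β ^ A' →
      ∀ᶠ L : ℕ in Filter.atTop, |β ^ 2 * (wilsonExpectation (L := L + 1) r.ρ β (toTorusObservable (L + 1) fun U =>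
          plaqCost0 (d := 4) r.ρ 1 2 U * plaqCost0 (d := 4) r.ρ 1 2 (timeShiftLG (G := G) n U)) -
        wilsonExpectation (L := L + 1) r.ρ β (toTorusObservable (L + 1) (plaqCost0 (d := 4) r.ρ 1 2)) *
          wilsonExpectation (L := L + 1) r.ρ β (toTorusObservable (L + 1) fun U =>
            plaqCost0 (d := 4) r.ρ 1 2 (timeShiftLG (G := G) n U))) -
        σ' * (curvaturePlaquetteCorr (d := 4) (by norm_num) (n : ℤ)) ^ 2| ≤ C' * β ^ (-κ') := by
  refine ⟨min (κ - s) s, A, |C| + |M|, σ, max β₀ 1, lt_min (by linarith) hs, hA, hσ, fun β hβ n hn1 hn2 => ?_⟩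
  have low := lowerLaw_of_posSource_at G r (κ := κ) (C := C) (M := M) (σ := σ)
    (fun β' hβ' n hn1 hn2 => hKS β' hβ' n hn1 hn2 (β' ^ (-s)) (Or.inl rfl)) β hβ n hn1 hn2
  have hm' : ∀ β' : ℝ, β₀ ≤ β' → ∀ n : ℕ, 1 ≤ n → (n : ℝ) ≤ 2 * β' ^ A → ∀ᶠ L : ℕ in Filter.atTop,
      ((L + 1 : ℝ) ^ 4)⁻¹ * Real.log (wilsonExpectation (L := L + 1) r.ρ β' fun U => Real.exp (β' ^ (-s) *
          ∑ x : Fin 4 → Fin (L + 1),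
          toTorusObservable (L + 1) (fun V => (β' * plaqCost0 (d := 4) r.ρ 1 2 (configShift (fun i => -((x i : ℕ) : ℤ)) V) -
            β' * wilsonExpectation (L := L + 1) r.ρ β' (toTorusObservable (L + 1) (plaqCost0 (d := 4) r.ρ 1 2))) *
            (β' * plaqCost0 (d := 4) r.ρ 1 2 (timeShiftLG (G := G) n (configShift (fun i => -((x i : ℕ) : ℤ)) V)) -
              β' * wilsonExpectation (L := L + 1) r.ρ β' (toTorusObservable (L + 1) (plaqCost0 (d := 4) r.ρ 1 2)))) U)) ≤
          β' ^ (-s) * (σ * (curvaturePlaquetteCorr (d := 4) (by norm_num) (n : ℤ)) ^ 2) + C * β' ^ (-κ) +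
            M * (β' ^ (-s)) ^ 2 := by
    intro β' hβ' n hn1 hn2
    filter_upwards [hKS β' hβ' n hn1 hn2 (-(β' ^ (-s))) (Or.inr rfl)] with L hL
    simpa only [neg_neg, even_two, Even.neg_pow] using hL
  have up := upperLaw_of_negSource_at G r (κ := κ) (C := C) (M := M) (σ := σ) hm' β hβ n hn1 hn2
  filter_upwards [low, up] with L hL hU
  rw [abs_le]
  constructor <;> linarith

end OneStrength

/-- **`EntropyBudgetTransfer` from the two-signed sourced pressure bound at the single strength `h = ±β^(−s)`** (`0 < s < κ`,
common `σ`, at every `(G, r)`).  A reduction of a RECORD-label rung crux; NOT the Clay mass gap. [folklore] -/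
theorem entropyBudgetTransfer_of_twoSignedSource_at
    (hKS : ∀ (G : Type) [Group G] [TopologicalSpace G] [IsTopologicalGroup G] [CompactSpace G], IsCompactSimpleLieGroup G →
      letI : MeasurableSpace G := borel G; haveI : BorelSpace G := ⟨rfl⟩; ∀ r : LatticeRep G,
      ∃ κ s A M C σ β₀ : ℝ, 0 < s ∧ s < κ ∧ 0 < A ∧ 0 < σ ∧ ∀ β : ℝ, β₀ ≤ β → ∀ n : ℕ, 1 ≤ n → (n : ℝ) ≤ 2 * β ^ A →
      ∀ h : ℝ, (h = β ^ (-s) ∨ h = -(β ^ (-s))) → ∀ᶠ L : ℕ in Filter.atTop,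
        ((L + 1 : ℝ) ^ 4)⁻¹ * Real.log (wilsonExpectation (L := L + 1) r.ρ β fun U => Real.exp (-h * ∑ x : Fin 4 → Fin (L + 1),
          toTorusObservable (L + 1) (fun V => (β * plaqCost0 (d := 4) r.ρ 1 2 (configShift (fun i => -((x i : ℕ) : ℤ)) V) -
            β * wilsonExpectation (L := L + 1) r.ρ β (toTorusObservable (L + 1) (plaqCost0 (d := 4) r.ρ 1 2))) *
            (β * plaqCost0 (d := 4) r.ρ 1 2 (timeShiftLG (G := G) n (configShift (fun i => -((x i : ℕ) : ℤ)) V)) -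
              β * wilsonExpectation (L := L + 1) r.ρ β (toTorusObservable (L + 1) (plaqCost0 (d := 4) r.ρ 1 2)))) U)) ≤
          -h * (σ * (curvaturePlaquetteCorr (d := 4) (by norm_num) (n : ℤ)) ^ 2) + C * β ^ (-κ) + M * h ^ 2) :
    Summit.QuantumFields.YangMills.Theses.EntropyBudgetEquipartition.EntropyBudgetTransfer := by
  intro G _ _ _ _ hG
  letI : MeasurableSpace G := borel G
  haveI : BorelSpace G := ⟨rfl⟩
  intro r _
  obtain ⟨κ, s, A, M, C, σ, β₀, hs, hsκ, hA, hσ, h⟩ := hKS G hG r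
  exact twoSidedLaw_of_twoSignedSource_at G r hs hsκ hA hσ h

end Summit.QuantumFields.YangMills.Theorems.EntropyBudgetEquipartition.SingleStrengthSource

end
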